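/-
Copyright (c) 2026 the pub-hodgecm-mathlib formalisation cell (harness21).  Typer seat hodgecm-mathlib-typ-T5a (g0), topic T5 = P8
«(C♯)hol interior», 2026-08-31.  Statement-only Literature module: ONE named fact, no proof.
-/
import Literature.NumberTheory.Automorphic.Liu2021.ThetaLiftFromLineMeets
import Literature.NumberTheory.Automorphic.Liu2021.Def411WeilCarriersAtLine
import Literature.NumberTheory.Automorphic.UnitaryGroupLevelTransport
import HarnessLib

/-!
# [Liu2021, Prop. 4.13 proof Case 1, «In other words … `π^∞ ≃ ω(μ, ε_e, χ)`»; Rallis 1984 §1 (localisation of a global theta lift)] —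
# THE FINITE COMPONENT OF A GLOBAL THETA LIFT FROM THE LINE `⟨a⟩` IS THE OSCILLATOR REPRESENTATION `ω(μ, ε_a, χ)_f` (node B of the (C♯)hol interior)

Topic `NumberTheory/Automorphic/Liu2021`; namespace `Literature.NumberTheory.Automorphic.Liu2021`.  STATEMENT-ONLY: ONE closed named fact
`def meetsThetaLiftFromLine_hasFinComponent_rhoAtLine : Prop` (no `sorry`, no instance, no notation); imports = tree (★ `ThetaLiftFromLineMeets`,
★ `Def411WeilCarriersAtLine` for `rhoAtLine`, ★ `UnitaryGroupLevelTransport` for `toFinAdeleGL`).  Cell hodgecm-mathlib FLOOR 0, programme P2,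
topic T5 = P8: the LOCAL–GLOBAL node joining the D1 seam (★ `MeetsThetaLiftFromLine`, letter A `cohHol_meetsThetaLiftFromLine`) to the
conclusion `P.HasFinComponent (rhoAtLine … ιV a χ)` of the booked letter (C♯)hol `Literature.NumberTheory.Rogawski1990.cohFinComponent_isThetaSigned_hol`
(★ p824128).  Frame = (C♯)hol's VERBATIM (both transports: the finite-adelic `ιV = (k ↦ g_f⁻¹ k g_f)` of (C♯)hol and the adelic `ιA` of letter A).

PRINT.  [Liu2021, proof of Prop. 4.13 Case 1, FJcycle.tex l. 2136–2137; Camb. J. Math. 9 (2021) p. 48]: «By Corollary B.6 (1), we have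
`V_π = Θ^V_{(μ⁻¹,ν⁻¹),−W}(π_W)`.  Note that the central character `χ` of `π` satisfies `χ_∞ = 1`.  In other words, there is a unique element
`e ∈ E^{−×}/Nm_{E/F}E^×` determined by `W` such that `π^∞ ≃ ω(μ, ε_e, χ)`, where `ε_e` is the collection given by `e`.»  With Def. 4.11
(l. 2092–2096, p. 46): «`ω(μ, ε, χ) := ⊗'_v ω(μ_v, ε_v, χ_v)`, which is an irreducible admissible representation of `𝔾(𝔸_F^∞)`», App. D §D.1
Step 3 (l. 5221): «Let `ω(μ, ε, χ)` be the maximal quotient of the representation `ω(ε, μ)` of `U(V)` with central character `χ`», and the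
compatibility of a global theta lift with the local theta correspondence [Rallis1984, proof of Thm. 1.2.2 p. 356: a non-zero global pairing
between `Θ(π)` and a form yields, at each place, a non-zero invariant form on `S ⊗ π_v ⊗ σ_v`]; for the pair `(U(V), U(W))`, `dim W = 1`,
`U(W) = E¹` is the CENTRE of `U(V)` and the local theta lift of the character `χ_v` of `U(W)(F_v)` IS `ω(μ_v, ε_v, χ_v)` by definition
(Step 3); [GelbartRogawski1991, §3.2 p. 457] (`n = 3`).

TYPING (the tree's reading, nothing re-declared).  If `P` contains a non-zero theta vector from `⟨a⟩` at the `μ`-splitting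
(`MeetsThetaLiftFromLine … P μ hμ a ιA`) and `P` is `H¹`-cohomological holomorphic at `ι` (`IsHolCotangentAt`, which is what forces
«`χ_∞ = 1`»: the archimedean centre `U(1)(L ⊗ ℝ)` acts trivially on cotangent forms), then for SOME automorphic character `χ` of
`E¹\(𝔸_E^∞)¹` (★ `Def411WeilCarriers.Chi`, [Liu2021, Def. 4.11] third bullet) the carrier `ω(μ, ε_a, χ)_f = rhoAtLine … ιV a χ` — the
`χ`-coinvariants of the finite Weil representation of `U(diag dV) × U(⟨a⟩)` at the SAME `μ`-attached splitting ★ `chiSplittingLine`, acted on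
by `U(H)(𝔸_{L⁺,f})` through `ιV` — OCCURS in `P` (★ `HasFinComponent`: an injective equivariant map into `P|_{U(H)(𝔸_f)}`).  In-house road
(why this node is PAYABLE modulo booked letters, size L): resolve the weight `f` into characters of the compact abelian `[U(⟨a⟩)]`
(★ `UnitaryDualPairThetaLiftCharacterSpan`), use the `(U(⟨a⟩)(𝔸), χ̃)`-covariance of `Φ ↦ Θ_Φ(χ̃)` (★ `UnitaryDualPairThetaLiftCharacterCovariance`:
the character lift FACTORS through the `χ̃`-coinvariants), separate the `χ̃` by the central character of the irreducible `P`, split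
`𝒮(𝔸) = 𝒮_∞ ⊗ 𝒮_f` (★ `Li1992/SchwartzPairingFactorisation`, ★ `WeilCoinv.pairRep_finPairToAdelic_piSBReindex_tmul`), and conclude with the
irreducibility of the rank-3 carrier ([Liu2021, Lem. D.1], ★ `Def411WeilCarriersIrreducibleOfLemD1`) that the non-zero equivariant map
`rhoAtLine … a χ → P_f` is injective.

HONEST SCOPE.  (i) As printed (l. 2136) the statement is a one-line consequence of `V_π = Θ(π_W)`; in the tree it is the junction of the
theta-kernel datum's finite half with the Weil-carrier lane — real work (the (T)-join of GS-6 did the analogous junction for the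
frame transport).  (ii) Junk models: without `IsHolCotangentAt` the `∃ χ : Chi` may fail (a theta vector of a character `χ̃` with
`χ̃_∞ ≠ 1` has finite type outside `Chi`); with `ιV`, `ιA` unpinned the statement would compare different groups.  (iii) Nothing archimedean
is concluded (node C).  HC_CM is proved only modulo the printed citations until rung 0 closes; filing this file books ONE printed statement.

## References
* [Liu2021] Y. Liu, Camb. J. Math. 9 (2021) = arXiv:2102.11518: proof of Prop. 4.13 Case 1 (l. 2136–2137, p. 48); Def. 4.11 (l. 2083–2097,
  p. 46); App. D §D.1 Steps 1–3 (l. 5217–5221), Lem. D.1 (p. 125).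
* [Rallis1984] S. Rallis, *On the Howe duality conjecture*, Compositio Math. 51 (1984) 333–399, proof of Thm. 1.2.2 p. 356.
* [GelbartRogawski1991] S. Gelbart, J. Rogawski, Invent. Math. 105 (1991), §3.2 p. 457.
* [BorelJacquet1979] A. Borel, H. Jacquet, PSPM 33.1 (1979), §4.6 (`π ≅ π_∞ ⊗ π_f`).
-/

noncomputable section

open NumberField NumberField.InfinitePlace MeasureTheory IsDedekindDomain
open scoped Matrix ComplexOrder

namespace Literature.NumberTheory.Automorphic.Liu2021

open _root_.MeasureTheory
open Literature.NumberTheory.Automorphic Literature.NumberTheory.Automorphic.UnitaryGroup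
open Literature.NumberTheory.Automorphic.UnitaryGroup.CotangentForms
open Literature.NumberTheory.Automorphic.IdeleClassGroup
open Literature.NumberTheory.Automorphic.Liu2021.Def411WeilCarriers
open Literature.NumberTheory.Automorphic.Liu2021.Def411WeilCarriersDoubling
open Literature.NumberTheory.GelbartRogawski1991 Literature.NumberTheory.GelbartRogawski1991.UnitaryDualPair
open Literature.RepresentationTheory.Liu2021

/-- **Node B of the (C♯)hol interior [Liu2021, Prop. 4.13 proof Case 1, l. 2136–2137 «In other words … `π^∞ ≃ ω(μ, ε_e, χ)`»; Def. 4.11;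
App. D §D.1 Step 3; Rallis1984 Thm. 1.2.2 (proof); GelbartRogawski1991 §3.2] — the finite component of a global theta lift from the line `⟨a⟩`
at the `μ`-splitting is `ω(μ, ε_a, χ)_f`**: in the frame of (C♯)hol, if the discrete `P` of `U(H)` contains a non-zero theta vector from `⟨a⟩`
(★ `MeetsThetaLiftFromLine … P μ hμ a ιA`) and is `H¹`-cohomological holomorphic at `ι` (so that «`χ_∞ = 1`»), then
`P.HasFinComponent (rhoAtLine … ιV a χ)` for some `χ ∈ Chi`.
[cite: Liu2021, Prop. 4.13 proof Case 1 (l. 2136–2137, p. 48); Def. 4.11 (l. 2092–2096); App. D §D.1 Step 3 (l. 5221)]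
[cite: Rallis1984, Thm. 1.2.2 proof p. 356] [cite: GelbartRogawski1991, §3.2 p. 457] [cite: BorelJacquet1979, §4.6] -/
def meetsThetaLiftFromLine_hasFinComponent_rhoAtLine : Prop :=
  ∀ (L : Type) [Field L] [NumberField L] [IsCMField L] (ι : L →+* ℂ) (H : Matrix (Fin 3) (Fin 3) L) (T : GL (Fin 3) ℂ)
    (hT : (T : Matrix (Fin 3) (Fin 3) ℂ)ᴴ * H.map ι * (T : Matrix (Fin 3) (Fin 3) ℂ) = Literature.Geometry.ComplexHyperbolic.BallModel.J),
    (∀ τ' : L →+* ℂ, InfinitePlace.mk τ' ≠ InfinitePlace.mk ι → (H.map τ').PosDef) → 2 ≤ Module.finrank ℚ ↥(maximalRealSubfield L) →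
    ∀ {n' : ℕ} (e₁ : Fin 3 × Fin 1 ≃ Fin n') (dV : Fin 3 → L) (hdV : ∀ i, IsCMField.complexConj L (dV i) = dV i)
      (hdV0 : ∀ i, dV i ≠ 0) (g : GL (Fin 3) L),
      ((g : Matrix (Fin 3) (Fin 3) L).map (cmConjRingHom L))ᵀ * H * (g : Matrix (Fin 3) (Fin 3) L) = Matrix.diagonal dV →
    ∀ (ιV : finAdelic (↥(maximalRealSubfield L)) L (IsCMField.complexConj L) 3 H →*
        finAdelic (↥(maximalRealSubfield L)) L (IsCMField.complexConj L) 3 (Matrix.diagonal dV)),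
      (∀ k, ((ιV k : finAdelic (↥(maximalRealSubfield L)) L (IsCMField.complexConj L) 3 (Matrix.diagonal dV)) :
            GL (Fin 3) (FiniteAdeleRing (𝓞 L) L)) =
          (toFinAdeleGL L 3 g)⁻¹ * (k : GL (Fin 3) (FiniteAdeleRing (𝓞 L) L)) * toFinAdeleGL L 3 g) →
    ∀ (ιA : (adelicGroupData (↥(maximalRealSubfield L)) L (IsCMField.complexConj L) 3 H).Adelic →*
        ↥(UnitaryGroup.adelic (↥(maximalRealSubfield L)) L (IsCMField.complexConj L) 3 (Matrix.diagonal dV))),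
      (∀ k, ((ιA k : ↥(UnitaryGroup.adelic (↥(maximalRealSubfield L)) L (IsCMField.complexConj L) 3 (Matrix.diagonal dV))) :
            GL (Fin 3) (AdeleRing (𝓞 L) L)) =
          (toAdeleGL L g)⁻¹ * adelicVal (↥(maximalRealSubfield L)) L (IsCMField.complexConj L) 3 H k * toAdeleGL L g) →
    ∀ [CompactSpace (↥(UnitaryGroup.adelic (↥(maximalRealSubfield L)) L (IsCMField.complexConj L) 3 (Matrix.diagonal dV)) ⧸
        (UnitaryGroup.toAdelic (↥(maximalRealSubfield L)) L (IsCMField.complexConj L) 3 (Matrix.diagonal dV)).range)],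
    ∀ (μA : Measure (adelicGroupData (↥(maximalRealSubfield L)) L (IsCMField.complexConj L) 3 H).automorphicQuotient)
      [(adelicGroupData (↥(maximalRealSubfield L)) L (IsCMField.complexConj L) 3 H).IsAutomorphicMeasure μA],
      ∀ (P : DiscreteAutomorphicRep (adelicGroupData (↥(maximalRealSubfield L)) L (IsCMField.complexConj L) 3 H) μA)
        (μ : Literature.NumberTheory.Automorphic.IdeleClassGroup L →ₜ* Circle) (hμ : IsConjugateSymplectic L μ)
        (a : (↥(maximalRealSubfield L))ˣ),
        MeetsThetaLiftFromLine L 3 H e₁ dV hdV hdV0 P μ hμ a ιA →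
        P.IsHolCotangentAt (cmArchSection L ι H T hT) (cmCompactFactor L ι H T hT) →
          ∃ χ : Chi (↥(maximalRealSubfield L)) L (IsCMField.complexConj L),
            P.HasFinComponent
              (rhoAtLine (↥(maximalRealSubfield L)) L (IsCMField.complexConj L) 3 e₁ (Matrix.diagonal dV)
                (complexConj_imagUnit L) (imagUnit_ne_zero L) (imagUnit_mul_self L) (realDiagonal_isSymm L dV hdV)
                (isUnit_det_realDiagonal L dV hdV hdV0) (realDiagonal_map L dV hdV).symm
                (fun a => isCompatible_chiSplittingLine L e₁ dV hdV hdV0 (toHeckeCharacter L μ)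
                  (isUnitary_toHeckeCharacter L μ) ((isOscillatorChar_toHeckeCharacter_iff μ).mpr hμ)
                  (TW (↥(maximalRealSubfield L)) a) (isSymm_TW (↥(maximalRealSubfield L)) a)
                  (isUnit_det_TW (↥(maximalRealSubfield L)) a) (JW (↥(maximalRealSubfield L)) L a)
                  (JW_eq (↥(maximalRealSubfield L)) L a)) ιV a χ)

end Literature.NumberTheory.Automorphic.Liu2021

end
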